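import Summits.BirchSwinnertonDyer.BirchSwinnertonDyer.Theorems.EisensteinPrimesCasselsTateDecisionRankOne
import Summits.BirchSwinnertonDyer.Rank1Residual.X11b.ChaPairsMinimality
import HarnessLib

/-!
# Row A2 (X1b, type B, `r_an = 1`), the one NOUNIT class: `BSD(371522j1, 3)` through the Cassels–Tate flat-cell door by a SECOND
# `3`-DESCENT — display of JOB DESIGN #60 «CT2ISO-371522j» (cell `bsd-eis`, seat `bsd-eis-k5-p4` g5; THEOREMS ONLY — per-pair
# instrument certificate feeding the READ binders of a GZK + Cassels–Tate kernel door; nothing booked; no label or count moves here)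

HONEST FRAMING (cell `bsd-eis`, run/shared/lean/pub/bsd-eis/; files of record `pub/bsd-eis/k5-p4-g5/`). Class 371522j = {j1, j2}
(Cremona; `N = 2·431²`, `3`-isogeny `φ : j1 → j2` with kernel polynomial `x + 36`, `r_an = 1` on both, `#E(ℚ)_tors = 1/1`,
`#Ш_an = 9` on both members) is the ONLY `p`-isogeny edge of the reducible-`E[p]` rank-`≤ 1` descent universes of this cell with
`p ∣ #Ш_an` on both members (k5-p4 g3 «Cassels edge identity audit», 79 969 edges); the two first `3`-isogeny descents (isogchi ‖
isogcft, and a third own GP engine here) give `S^{(φ)}(j1) ≅ ℤ/3 = Ш(j1)[φ]`, `dim S^{(φ̂)}(j2) = 2` with Mordell–Weil part `1`, hence the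
WINDOW `0 ≠ Ш(j1)[3]`, `#Ш(j1)[3] ∣ 9` (`0 → Ш(j1)[φ] → Ш(j1)[3] → Ш(j2)[φ̂]`) — READ below as `hdvd`. The door
`CasselsTateDecision.bsdp_of_val_two_of_exists_torsion_not_mem_range` (p568444; Gross–Zagier–Kolyvagin `hGZK` + Cassels–Tate `hCT`
the only named facts; no Kato/Wuthrich upper half, no main conjecture, no `p`-adic height, no Schneider) then turns ONE element
`a ∈ Ш(j1)[3]` that is NOT a `3`-rd multiple in `Ш(j1)` into `BSD(j1, 3)` — READ below as `hwit`.

THE CERTIFICATE behind `hwit` (JOB DESIGN #60; evidence on stmt-BirchSwinnertonDyer-19035; NOTE `pub/bsd-eis/k5-p4-g5/NOTE-371522j-CT2ISO.md`):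
(1) SECOND φ-DESCENT (Creutz–Miller, J. Algebra 372 (2012) [arXiv:1105.4018] §§3–6 with `ℓ = 3`; own GP implementation `ct2iso.gp`,
kit j290722) on the `φ̂`-covering `C_u : −3662p³ − (65509407q + 78125r)p² + 4734966pq² + 9411518139q³ − 33671875q²r + 27584r³ = 0`
(Jacobian `j2`, class `c` = the generator of `Ш(j2)[φ̂]`; `u = −21836469 − 3662√−431`, `N(u) = 78125³`): flex field
`F = ℚ[t]/(t³ − 33t − 60)`, `F(S,3)` of dimension `9` (`S = {2,3,5,431}`, `bnfcertify = 1`), every local image certified at the Schaefer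
dimension, algebraic Selmer set of EXACTLY `3 = #S^{(φ)}(j1)` classes (the count the theory forces), and by Creutz–Miller Thm 5.1 the
three plane cubics (p-minimised + reduced, `disc = Δ_min(j1) = −11316205852714110611456`, Jacobian `≅ j1` on two engines — PARI
`ellfromeqn` ‖ ctpB `cubicjac`, everywhere locally soluble, `ρ_i : D_i → C_u` an exact polynomial identity):
`D₁ = 32x³+48x²y+14x²w+4xy²−7xyw−34xw²+16y³−4y²w+45yw²+8w³`, `D₂ = 10x³−12x²y−5x²w+46xy²+51xyw+58xw²−28y³+40y²w−7yw²−7w³`,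
`D₃ = 20x³−6x²y−82x²w−24xy²+19xyw+6xw²+56y³−18y²w+5yw²−4w³`, representing the three classes `b, b ± a ∈ Ш(j1)[3] ∖ Ш(j1)[φ]` over `c`
(`φb = c ≠ 0`, so `b ≠ 0` and `3b = φ̂φb = 0`). (2) SECOND `3`-DESCENT (Creutz, Math. Comp. 83 (2014) §7, Alg. 7.3 F-part) on each `D_i`
with the two route-C9 engines of cell b2b-bsdres x10 GEN 45, byte-identical (`ninedesc.gp` r4 cb782592…, PARI/GP, `bnfcertify` flag 1 +
residue-character completeness ‖ `ninedesc_e2.py` r3.1 bd06eaa2…, SageMath 10.9): flex field of degree `9` (disc `−3⁹·431⁶`), local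
images certified at `2, 3, 431`, affine `𝔽₃`-system INCONSISTENT on BOTH engines for EACH of `D₁, D₂, D₃` (kit j290772 ‖ j290773) ⇒
`Sel^{(3)}(D_i/ℚ) = ∅` ⇒ `[D_i] ∉ 3Ш(j1)` (Creutz–Miller 2012 Lemma 2.3 with the isogeny `[3]`). Controls of both signs in the same
run (kit j290864 ‖ j290863): same-curve positive `371522j1_pos` (the `3`-covering `Q ↦ 3Q + P₁` of `j1`, rational points ⇒ consistent),
x10's `4225j1_neg1` / `384400cx1_neg81a` (must be consistent) and `110224f1_pr1` (CTP-backed, must be EMPTY).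

**READ (hypotheses):** `hr : r_an = 1` (Cremona; PARI `ellanalyticrank`), `hq`/`hv` : `#Ш_an = 9`, `ord_3 9 = 2` (Cremona `allbsd` =
PARI leg on both members, k5-p4 g3), `hdvd : #Ш(j1)[3] ∣ 3²` (the two first `3`-isogeny descents, three engines), `hwit` (the second
`3`-descent above). **PUBLISHED facts BY NAME:** `hGZK`, `hCT` only. What this is NOT: not a class theorem (row A2 / crux 6
`SchneiderOnX1TypeB` are untouched class-wide); not new mathematics (Creutz–Miller 2012 + Creutz 2014 + Cassels 1962, bookkept); `BSDp`
is Miller's per-prime formula (`MissingPPartAt`), whose rank clause is GZK. Nothing is booked here; the referee prices the binders.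
References: [CreutzMiller2012] Lemma 2.3, Thm 5.1, Thm 6.2; Creutz, Math. Comp. 83 (2014) 365–409, §7; [Cassels1962ArithmeticIV]
Thm 1.1; [SilvermanAEC2009] X.4.2, X.4.14; [Miller2011LMS] §1, Def. 1.1; Schaefer, J. Number Theory 56 (1996) Lemma 3.8; Cremona
`ecdata` class 371522j.
-/

set_option autoImplicit false
set_option linter.dupNamespace false

noncomputable section

open scoped Classical AddSubgroup

open WeierstrassCurve Literature.NumberTheory.EllipticCurves
  Literature.NumberTheory.EllipticCurves.ModularForms
  Literature.NumberTheory.EllipticCurves.Rank1Residual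
  Literature.NumberTheory.EllipticCurves.Rank1Residual.Typed
  Summit.BirchSwinnertonDyer.BirchSwinnertonDyer.Theorems

namespace Summit.BirchSwinnertonDyer.BirchSwinnertonDyer.Theorems.A2SecondDescent371522j1

/-- `371522j1 = [1, 0, 0, 1482218, -5070625244]` is elliptic (`Δ = −2¹²·431⁷ ≠ 0`). [cite: SilvermanAEC2009, III.1] -/
theorem isElliptic_371522j1 : (⟨1, 0, 0, 1482218, (-5070625244)⟩ : WeierstrassCurve ℚ).IsElliptic :=
  Summit.BirchSwinnertonDyer.Rank1Residual.X11b.isElliptic_of_discOf_ne_zero 1 0 0 1482218 (-5070625244) (by decide +kernel)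

/-- **X1b NOUNIT INSTANCE, SECOND-`3`-DESCENT ROAD — `BSD(371522j1, 3)`** from Gross–Zagier–Kolyvagin (`hGZK`) and Cassels–Tate
(`hCT`) through the flat-cell door `CasselsTateDecision.bsdp_of_val_two_of_exists_torsion_not_mem_range`, given the READS on
`371522j1`: `r_an = 1`, `#Ш_an = 9` (`ord₃ = 2`), the first-descent window `#Ш[3] ∣ 9`, and ONE `3`-torsion class of `Ш` that is not a
`3`-rd multiple — the second `3`-descent certificate `Sel^{(3)}(D_i/ℚ) = ∅` (both engines, JOB DESIGN #60). No Iwasawa theory, no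
`p`-adic height, no upper-half theorem. Nothing booked; `BSDp` only.
[cite: CreutzMiller2012, Lemma 2.3] [cite: SilvermanAEC2009, Thm. X.4.2 and X.4.14] [cite: Miller2011LMS, §1 and Def. 1.1] -/
theorem bsdp_371522j1_at_three_of_secondDescent (hCT : exists_casselsTate_pairing (K := ℚ))
    (hGZK : rank_eq_analyticRank_of_analyticRank_le_one)
    (W : WeierstrassCurve ℚ) [W.IsElliptic] (hW : W = ⟨1, 0, 0, 1482218, (-5070625244)⟩)
    (hr : W.analyticRank = 1) {q : ℚ} (hq : shaAn W = (q : ℂ)) (hv : padicValRat 3 q = 2)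
    (hdvd : Nat.card (W.sha[((3 : ℕ) : ℤ)]) ∣ 3 ^ 2)
    (hwit : ∃ a : W.sha, (3 : ℕ) • a = 0 ∧ a ∉ (nsmulAddMonoidHom (α := W.sha) 3).range) : BSDp W 3 := by
  subst hW
  exact CasselsTateDecision.bsdp_of_val_two_of_exists_torsion_not_mem_range _ 3 hCT hGZK (by omega) hdvd hwit hq hv

/-- **The same on the row's shape `r_an = 1 → BSDp W 3`** for the record curve, modulo GZK + CT and the three reads.
[cite: Miller2011LMS, §1 and Def. 1.1] -/
theorem rankOne_bsdp_371522j1_of_secondDescent (hCT : exists_casselsTate_pairing (K := ℚ))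
    (hGZK : rank_eq_analyticRank_of_analyticRank_le_one)
    (W : WeierstrassCurve ℚ) [W.IsElliptic] (hW : W = ⟨1, 0, 0, 1482218, (-5070625244)⟩)
    {q : ℚ} (hq : shaAn W = (q : ℂ)) (hv : padicValRat 3 q = 2)
    (hdvd : Nat.card (W.sha[((3 : ℕ) : ℤ)]) ∣ 3 ^ 2)
    (hwit : ∃ a : W.sha, (3 : ℕ) • a = 0 ∧ a ∉ (nsmulAddMonoidHom (α := W.sha) 3).range) :
    W.analyticRank = 1 → BSDp W 3 :=
  fun hr ↦ bsdp_371522j1_at_three_of_secondDescent hCT hGZK W hW hr hq hv hdvd hwit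

end Summit.BirchSwinnertonDyer.BirchSwinnertonDyer.Theorems.A2SecondDescent371522j1

end
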